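import Mathlib.Analysis.Calculus.MeanValue
import Summits.QuantumFields.YangMills.Theorems.FluctuationComparisonRegPrIntLOrganTangentPullbackRowMass
import HarnessLib

/-!
# Crux `FluctuationComparisonRegPrIntL` (stmt-QuantumFields-20520, rung R3), PATH-B organ — «JT-CURV» (A)+(B):
# THE DIFFERENTIAL, CURVATURE-INDEXED PULL-BACK SQUARE (abstract, DEFINITION-FREE; the (JT-h) DISCHARGER's first door)

Cell `ym3-torus` (YM ladder rung R3 = continuum `SU(2)` Yang–Mills on the three-torus — a RUNG: NOT d = 4, NOT infinite volume, NOT a mass gap, NOT Clay).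
Width seat `ym3-torus-px19` (gen 20); LOCATE `HOME/ym3-torus-px19/g20/LOCATE-JT-DISCHARGER-DOOR-px19g20.md` (a69adec5) §4 (N1); `--kind proof --supports
stmt-QuantumFields-20520 --as helper`, count-neutral, no registry ∕ binder ∕ `Lines/` edit, default heartbeats, `autoImplicit false`, Mathlib-only mathematics.

WHY.  The (JT-h) clause of the FROZEN row `SpreadFibreLawH` (v0.3m) asks for m-UNIFORM coarse pair letters of the composite `V ↦ h_Ts(Φ(V,z))`.  Every
LINK-indexed discrete telescope (✓BRICK 2a `…OrganTangentPullbackSquare`, ✓RM-PB `…OrganTangentPullbackRowMass`, T2∕T2′, MH-PULLBACK) charges `Σ_b |ξ_b|` of the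
response link field and is certified `× L^{2m}` (instr-1 FL-22b∕FL-23, `Σ_abs`), while CURVATURE-indexed sign-blind sums saturate (FL-23 `Σ_K0`, `Σ_K1`): a curvature
functional's Hessian acts on the PLAQUETTE speeds `dξ`, one power of the block side smaller per factor, and only a SMOOTH homotopy (all bonds moving at once) charges the
net plaquette speed — a discrete one-bond move changes its four plaquettes by the full move.  Hence the door is DIFFERENTIAL: the second difference over the coarse square
is the double integral of the mixed partial `∂_s∂_t (h∘Φ)(V(s,t), z)`, and the fine functional's second variation is charged on plaquette-indexed letters.

WHAT (abstract; the organ edition — smooth one-bond families `s ↦ U·expPt((s∕‖m‖)•m)@B`, plaquette speeds in `dist1`-rate — is a separate file once its spelling is fixed):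
§1 ★`abs_rectDiff_le_of_mixedDeriv` (CALCULUS CORE, Mathlib-only): for `F : ℝ → ℝ → ℝ` with `t ↦ F 0 t`, `t ↦ F a t` differentiable on `[0,b]` (derivatives `F₂ 0 ·`,
   `F₂ a ·`) and `s ↦ F₂ s t` differentiable on `[0,a]` with derivative `F₁₂ s t`, `|F₁₂| ≤ M` on the rectangle: `|F a b − F a 0 − F 0 b + F 0 0| ≤ M·a·b`
   (two applications of the 1-D mean-value inequality `norm_image_sub_le_of_norm_deriv_le_segment'`).
§2 ★★`abs_rectDiff_le_curvLetters` (LETTER EDITION): if on the rectangle `|F₁₂ s t| ≤ Σ_{p q} α p s t·k̃ p q·α′ q s t + Σ_p g̃ p·γ p s t` with SPEED profiles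
   `0 ≤ α p ≤ KP p`, `0 ≤ α′ q ≤ KP′ q`, ACCELERATION profiles `0 ≤ γ p ≤ KP2 p` and `k̃, g̃ ≥ 0`, then
   `|F a b − F a 0 − F 0 b + F 0 0| ≤ (Σ_{p q} KP p·k̃ p q·KP′ q + Σ_p g̃ p·KP2 p)·a·b` — i.e. the coarse pair letter is `k′_curv B B′ := KP(·,B)ᵀ k̃ KP(·,B′) + g̃ᵀ KP2(·,B,B′)`,
   EXACTLY ✓2a §3's shape `C·Xᵀ k X + gᵀ Y` with `C = 1` and the index type `ι := fine PLAQUETTES`; so ✓RM-PB `rowMass_pullback_letters(_exp∕_proj)` gives its κ-row mass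
   `NcolP·w̃·NrowP + G̃·NYP` VERBATIM (both files are abstract in `ι`) — m-uniformity ⟺ «`NcolP·NrowP`, `NYP` m-uniform» (FL-23's saturating `Σ_K0`), nothing to re-prove here.
§3 `abs_rectDiff_le_curvLetters_sz` — the same with the rectangle `[0, szc m] × [0, szc m′]` spelled as the organ's sizes (`a := ‖m‖∕θc`, `b := ‖m′‖∕θc`), for docking.
§4 ★`rowMass_curvLetters` — THE DOCKING BY KERNEL: the κ-row mass of `k′_curv` is ✓RM-PB `rowMass_pullback_letters` at `C := 1`, `ι := ιP` (plaquette-indexed column ∕ row ∕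
   second-order masses `NcolP, NrowP, NYP`, fine curvature row mass `w̃`, gradient cap `G̃`, multiplicative weight triangle): `Σ_{B′} k′_curv B B′·ωc B B′ ≤ NcolP·w̃·NrowP + G̃·NYP`.

INPUTS LEFT TO PRINT (hypotheses of the organ edition; LOCATE §4 (i)–(iii)): the curvature (plaquette-pair) clause `k̃, w̃, g̃` of the pinned `h_Ts` ([Balaban1987RG1]
(0.22)–(0.25) + Cauchy in curvature directions) and the plaquette speed∕acceleration letters `KP, KP2` of Bałaban's chart ([Balaban1985Variational] Thm 1 (9)–(10), Prop 9
(190); [Balaban1984PropagatorsI] Prop 1.2) — NOT constructed here.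

HONEST FRAMING: one-variable calculus and `Finset` bookkeeping over HYPOTHESIS profiles; nothing of Bałaban's analysis is asserted or proved; `SpreadFibreLawH(J)`, LIN″,
JEN″, JVARᵘ-H″, O1ᵘ-H v2.2, S1aᴴ, S3ᴴ, S2α′, S2β, 26243, the five registered stubs, crux 20520 `FluctuationComparisonRegPrIntL` and `YM3TorusSU2` are NOT proved; no
summit ∕ sub-problem statement is proved; registry `Lines/semiclassical_s2beta.lean` 3732b7df untouched; rung R3 = SU(2) YM₃ on T³ at fixed lattice data — NOT d = 4,
NOT infinite volume, NOT a mass gap, NOT Clay; the Yang–Mills mass gap is NOT proved.  [folklore]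
-/

set_option autoImplicit false

noncomputable section

namespace Summit.QuantumFields.YangMills.Theorems.OrganTangentPullbackSquareCurv

open Set
open scoped BigOperators

/-! ## §1 The calculus core: a second difference over a rectangle is bounded by the sup of the mixed partial × the area -/

/-- ★ **RECTANGLE SECOND DIFFERENCE ≤ sup|∂_s∂_t| × area.**  `F : ℝ → ℝ → ℝ`; `t ↦ F 0 t` and `t ↦ F a t` have derivatives `F₂ 0 t`, `F₂ a t` within `[0,b]`;
for every `t ∈ [0,b]`, `s ↦ F₂ s t` has derivative `F₁₂ s t` within `[0,a]`; `|F₁₂ s t| ≤ M` on `[0,a] × [0,b]`.  Then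
`|F a b − F a 0 − F 0 b + F 0 0| ≤ M·a·b`.  (Mean value twice: `G t := F a t − F 0 t` has `|G′| ≤ M·a`.) [folklore] -/
theorem abs_rectDiff_le_of_mixedDeriv (F F₂ F₁₂ : ℝ → ℝ → ℝ) {a b M : ℝ} (ha : 0 ≤ a) (hb : 0 ≤ b)
    (hF0 : ∀ t ∈ Icc (0 : ℝ) b, HasDerivWithinAt (fun t => F 0 t) (F₂ 0 t) (Icc 0 b) t)
    (hFa : ∀ t ∈ Icc (0 : ℝ) b, HasDerivWithinAt (fun t => F a t) (F₂ a t) (Icc 0 b) t)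
    (hF₁₂ : ∀ t ∈ Icc (0 : ℝ) b, ∀ s ∈ Icc (0 : ℝ) a, HasDerivWithinAt (fun s => F₂ s t) (F₁₂ s t) (Icc 0 a) s)
    (hM : ∀ s ∈ Icc (0 : ℝ) a, ∀ t ∈ Icc (0 : ℝ) b, |F₁₂ s t| ≤ M) :
    |F a b - F a 0 - F 0 b + F 0 0| ≤ M * a * b := by
  -- the inner mean value: `|F₂ a t − F₂ 0 t| ≤ M·a`
  have hinner : ∀ t ∈ Icc (0 : ℝ) b, ‖F₂ a t - F₂ 0 t‖ ≤ M * a := by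
    intro t ht
    have key := norm_image_sub_le_of_norm_deriv_le_segment' (f := fun s => F₂ s t) (f' := fun s => F₁₂ s t)
      (fun s hs => hF₁₂ t ht s hs) (fun s hs => by
        rw [Real.norm_eq_abs]; exact hM s (Ico_subset_Icc_self hs) t ht) a (right_mem_Icc.mpr ha)
    simpa using key
  -- the outer mean value on `G t := F a t − F 0 t`
  have hG : ∀ t ∈ Icc (0 : ℝ) b, HasDerivWithinAt (fun t => F a t - F 0 t) (F₂ a t - F₂ 0 t) (Icc 0 b) t :=
    fun t ht => (hFa t ht).sub (hF0 t ht)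
  have key := norm_image_sub_le_of_norm_deriv_le_segment' (f := fun t => F a t - F 0 t) (f' := fun t => F₂ a t - F₂ 0 t)
    hG (fun t ht => hinner t (Ico_subset_Icc_self ht)) b (right_mem_Icc.mpr hb)
  have hrw : (F a b - F 0 b) - (F a 0 - F 0 0) = F a b - F a 0 - F 0 b + F 0 0 := by ring
  rw [Real.norm_eq_abs, hrw, sub_zero] at key
  simpa [mul_assoc] using key

/-! ## §2 The letter edition: a curvature-indexed bilinear bound on the mixed partial integrates to ✓2a's letter shape `KPᵀ k̃ KP + g̃ᵀ KP2` -/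

variable {ιP : Type*} [Fintype ιP]

/-- Monotonicity of the structured bound: profiles below their letters. [folklore] -/
theorem structuredBound_le (kP : ιP → ιP → ℝ) (gP : ιP → ℝ) (α α' γ : ιP → ℝ) (KP KP' KP2 : ιP → ℝ)
    (hk : ∀ p q, 0 ≤ kP p q) (hg : ∀ p, 0 ≤ gP p)
    (hα : ∀ p, 0 ≤ α p ∧ α p ≤ KP p) (hα' : ∀ q, 0 ≤ α' q ∧ α' q ≤ KP' q) (hγ : ∀ p, 0 ≤ γ p ∧ γ p ≤ KP2 p) :
    (∑ p, ∑ q, α p * kP p q * α' q + ∑ p, gP p * γ p) ≤ ∑ p, ∑ q, KP p * kP p q * KP' q + ∑ p, gP p * KP2 p := by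
  refine add_le_add (Finset.sum_le_sum fun p _ => Finset.sum_le_sum fun q _ => ?_) (Finset.sum_le_sum fun p _ => ?_)
  · have h1 : α p * kP p q ≤ KP p * kP p q := mul_le_mul_of_nonneg_right (hα p).2 (hk p q)
    have h2 : 0 ≤ KP p * kP p q := mul_nonneg ((hα p).1.trans (hα p).2) (hk p q)
    calc α p * kP p q * α' q ≤ KP p * kP p q * α' q := mul_le_mul_of_nonneg_right h1 (hα' q).1
      _ ≤ KP p * kP p q * KP' q := mul_le_mul_of_nonneg_left (hα' q).2 h2
  · exact mul_le_mul_of_nonneg_left (hγ p).2 (hg p)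

/-- ★★ **CURVATURE-INDEXED PULL-BACK SQUARE (letter edition).**  If the mixed partial of `F` on `[0,a]×[0,b]` is bounded by the STRUCTURED bilinear form
`Σ_{p q} α p s t·k̃ p q·α′ q s t + Σ_p g̃ p·γ p s t` (plaquette-indexed letters `k̃, g̃ ≥ 0` of the fine functional; speed profiles `0 ≤ α ≤ KP`, `0 ≤ α′ ≤ KP′`,
acceleration profiles `0 ≤ γ ≤ KP2` of the chart), then the second difference over the rectangle is at most `(KPᵀ k̃ KP′ + g̃ᵀ KP2)·a·b` — ✓2a §3's letter shape with
`C = 1` at `ι := plaquettes`, so ✓RM-PB `rowMass_pullback_letters` prices its κ-row mass verbatim. [folklore] -/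
theorem abs_rectDiff_le_curvLetters (F F₂ F₁₂ : ℝ → ℝ → ℝ) {a b : ℝ} (ha : 0 ≤ a) (hb : 0 ≤ b)
    (hF0 : ∀ t ∈ Icc (0 : ℝ) b, HasDerivWithinAt (fun t => F 0 t) (F₂ 0 t) (Icc 0 b) t)
    (hFa : ∀ t ∈ Icc (0 : ℝ) b, HasDerivWithinAt (fun t => F a t) (F₂ a t) (Icc 0 b) t)
    (hF₁₂ : ∀ t ∈ Icc (0 : ℝ) b, ∀ s ∈ Icc (0 : ℝ) a, HasDerivWithinAt (fun s => F₂ s t) (F₁₂ s t) (Icc 0 a) s)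
    (kP : ιP → ιP → ℝ) (gP : ιP → ℝ) (α α' γ : ιP → ℝ → ℝ → ℝ) (KP KP' KP2 : ιP → ℝ)
    (hk : ∀ p q, 0 ≤ kP p q) (hg : ∀ p, 0 ≤ gP p)
    (hα : ∀ p, ∀ s ∈ Icc (0 : ℝ) a, ∀ t ∈ Icc (0 : ℝ) b, 0 ≤ α p s t ∧ α p s t ≤ KP p)
    (hα' : ∀ q, ∀ s ∈ Icc (0 : ℝ) a, ∀ t ∈ Icc (0 : ℝ) b, 0 ≤ α' q s t ∧ α' q s t ≤ KP' q)
    (hγ : ∀ p, ∀ s ∈ Icc (0 : ℝ) a, ∀ t ∈ Icc (0 : ℝ) b, 0 ≤ γ p s t ∧ γ p s t ≤ KP2 p)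
    (hbound : ∀ s ∈ Icc (0 : ℝ) a, ∀ t ∈ Icc (0 : ℝ) b,
      |F₁₂ s t| ≤ ∑ p, ∑ q, α p s t * kP p q * α' q s t + ∑ p, gP p * γ p s t) :
    |F a b - F a 0 - F 0 b + F 0 0| ≤ (∑ p, ∑ q, KP p * kP p q * KP' q + ∑ p, gP p * KP2 p) * a * b :=
  abs_rectDiff_le_of_mixedDeriv F F₂ F₁₂ ha hb hF0 hFa hF₁₂ fun s hs t ht =>
    (hbound s hs t ht).trans (structuredBound_le kP gP (fun p => α p s t) (fun q => α' q s t) (fun p => γ p s t) KP KP' KP2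
      hk hg (fun p => hα p s hs t ht) (fun q => hα' q s hs t ht) (fun p => hγ p s hs t ht))

/-! ## §3 Docking spelling: the rectangle `[0, ‖m‖∕θc] × [0, ‖m′‖∕θc]` -/

/-- The letter edition with the organ's sizes `szc m := ‖m‖∕θc`, `szc m′ := ‖m′‖∕θc` as the rectangle's sides (so the conclusion reads
`≤ k′_curv·(‖m‖∕θc)·(‖m′‖∕θc)` as an `HClauseSq`-shaped letter bound). [folklore] -/
theorem abs_rectDiff_le_curvLetters_sz {E : Type*} [SeminormedAddCommGroup E] (m m' : E) {θc : ℝ} (hθc : 0 < θc)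
    (F F₂ F₁₂ : ℝ → ℝ → ℝ)
    (hF0 : ∀ t ∈ Icc (0 : ℝ) (‖m'‖ / θc), HasDerivWithinAt (fun t => F 0 t) (F₂ 0 t) (Icc 0 (‖m'‖ / θc)) t)
    (hFa : ∀ t ∈ Icc (0 : ℝ) (‖m'‖ / θc), HasDerivWithinAt (fun t => F (‖m‖ / θc) t) (F₂ (‖m‖ / θc) t) (Icc 0 (‖m'‖ / θc)) t)
    (hF₁₂ : ∀ t ∈ Icc (0 : ℝ) (‖m'‖ / θc), ∀ s ∈ Icc (0 : ℝ) (‖m‖ / θc),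
      HasDerivWithinAt (fun s => F₂ s t) (F₁₂ s t) (Icc 0 (‖m‖ / θc)) s)
    (kP : ιP → ιP → ℝ) (gP : ιP → ℝ) (α α' γ : ιP → ℝ → ℝ → ℝ) (KP KP' KP2 : ιP → ℝ)
    (hk : ∀ p q, 0 ≤ kP p q) (hg : ∀ p, 0 ≤ gP p)
    (hα : ∀ p, ∀ s ∈ Icc (0 : ℝ) (‖m‖ / θc), ∀ t ∈ Icc (0 : ℝ) (‖m'‖ / θc), 0 ≤ α p s t ∧ α p s t ≤ KP p)
    (hα' : ∀ q, ∀ s ∈ Icc (0 : ℝ) (‖m‖ / θc), ∀ t ∈ Icc (0 : ℝ) (‖m'‖ / θc), 0 ≤ α' q s t ∧ α' q s t ≤ KP' q)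
    (hγ : ∀ p, ∀ s ∈ Icc (0 : ℝ) (‖m‖ / θc), ∀ t ∈ Icc (0 : ℝ) (‖m'‖ / θc), 0 ≤ γ p s t ∧ γ p s t ≤ KP2 p)
    (hbound : ∀ s ∈ Icc (0 : ℝ) (‖m‖ / θc), ∀ t ∈ Icc (0 : ℝ) (‖m'‖ / θc),
      |F₁₂ s t| ≤ ∑ p, ∑ q, α p s t * kP p q * α' q s t + ∑ p, gP p * γ p s t) :
    |F (‖m‖ / θc) (‖m'‖ / θc) - F (‖m‖ / θc) 0 - F 0 (‖m'‖ / θc) + F 0 0|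
      ≤ (∑ p, ∑ q, KP p * kP p q * KP' q + ∑ p, gP p * KP2 p) * (‖m‖ / θc) * (‖m'‖ / θc) :=
  abs_rectDiff_le_curvLetters F F₂ F₁₂ (div_nonneg (norm_nonneg _) hθc.le) (div_nonneg (norm_nonneg _) hθc.le)
    hF0 hFa hF₁₂ kP gP α α' γ KP KP' KP2 hk hg hα hα' hγ hbound

/-! ## §4 Docking by kernel: the κ-row mass of the curvature letters is ✓RM-PB at `C := 1`, `ι := plaquettes` -/

open Summit.QuantumFields.YangMills.Theorems.OrganTangentPullbackRowMass (rowMass_pullback_letters) in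
/-- ★ **ROW MASS OF THE CURVATURE LETTERS** (✓RM-PB `rowMass_pullback_letters` with `C := 1` and the fine index type read as PLAQUETTES): with column mass
`Σ_p KP p B·ωX p B ≤ NcolP`, row mass `Σ_{B′} KP q B′·ωX q B′ ≤ NrowP`, fine curvature row mass `Σ_q k̃ p q·ωf p q ≤ w̃`, gradient cap `g̃ ≤ G̃`, second-order mass
`Σ_p Σ_{B′} KP2 p B B′·ωc B B′ ≤ NYP` and the weight triangle `ωc B B′ ≤ ωX p B·ωf p q·ωX q B′`:
`Σ_{B′} (Σ_{p q} KP p B·k̃ p q·KP q B′ + Σ_p g̃ p·KP2 p B B′)·ωc B B′ ≤ NcolP·w̃·NrowP + G̃·NYP` — m-uniform iff `NcolP·NrowP`, `NYP` are (instr-1 FL-23 `Σ_K0`). [folklore] -/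
theorem rowMass_curvLetters {ιc : Type*} [Fintype ιc] (kP : ιP → ιP → ℝ) (gP : ιP → ℝ) (KP : ιP → ιc → ℝ) (KP2 : ιP → ιc → ιc → ℝ)
    (ωf : ιP → ιP → ℝ) (ωc : ιc → ιc → ℝ) (ωX : ιP → ιc → ℝ)
    (hk : ∀ p q, 0 ≤ kP p q) (hKP : ∀ p B, 0 ≤ KP p B) (hKP2 : ∀ p B B', 0 ≤ KP2 p B B')
    (hωf : ∀ p q, 0 ≤ ωf p q) (hωc : ∀ B B', 0 ≤ ωc B B') (hωX : ∀ p B, 0 ≤ ωX p B)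
    (htri : ∀ (B B' : ιc) (p q : ιP), ωc B B' ≤ ωX p B * ωf p q * ωX q B')
    {NcolP NrowP wP GP NYP : ℝ} (hw : 0 ≤ wP) (hNrow : 0 ≤ NrowP) (hG0 : 0 ≤ GP)
    (hcol : ∀ B, ∑ p, KP p B * ωX p B ≤ NcolP) (hrow : ∀ q, ∑ B', KP q B' * ωX q B' ≤ NrowP)
    (hkrow : ∀ p, ∑ q, kP p q * ωf p q ≤ wP) (hG : ∀ p, gP p ≤ GP)
    (hYmass : ∀ B, ∑ p, ∑ B', KP2 p B B' * ωc B B' ≤ NYP) (B : ιc) :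
    ∑ B', (∑ p, ∑ q, KP p B * kP p q * KP q B' + ∑ p, gP p * KP2 p B B') * ωc B B' ≤ NcolP * wP * NrowP + GP * NYP := by
  have h := rowMass_pullback_letters kP gP 1 KP KP2 ωf ωc ωX hk zero_le_one hKP hKP2 hωf hωc hωX htri hw hNrow hG0 hcol hrow
    hkrow hG hYmass B
  simpa only [one_mul] using h

end Summit.QuantumFields.YangMills.Theorems.OrganTangentPullbackSquareCurv

end
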